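import Summits.QuantumFields.BalabanUV.Beta.SymAveragingHessianCounts
import Summits.QuantumFields.BalabanUV.Beta.SymmetrisedAxialReflection
import Summits.QuantumFields.BalabanUV.Beta.SymAveragingWardRooted
import Literature.MathematicalPhysics.QuantumFieldTheory.Balaban1983to89.Beta.RootedKernelReflection
import Summits.QuantumFields.BalabanUV.Beta.SymRootedKernelReflectionCore

/-!
COURIER NOTE (b2b-balaban-beta-d1-formalise-leaf-05 gen 21, 2026-08-21): an1-g43's scratch file `s2e/SymRootedKernelReflection.lean` v1.1
(sha16 9d52695fba7df127, 503 l.; journal [AN1-G43-S2E-V11] l.34351) exceeds the tree's 400-line lint (`lint.size`, gate dry-run «this one has 504»),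
so it is filed as TWO modules with EVERY declaration byte-identical, in the original order and in the original namespace
`Summit.QuantumFields.BalabanUV.Beta.SymRootedKernelReflection` (all fully-qualified names unchanged):
`Beta.SymRootedKernelReflectionCore` = §§1–5 (letter lists, pair words, counts, the count sign laws; 0 def) and THIS module
`Beta.SymRootedKernelReflection` = §§6–8 (real kernels, transport, the def `symCtE`, packed laws, `hHr_sym`; imports the Core).
The module docstring below is an1's v1.1, verbatim, and describes BOTH parts; S2e #2 `Beta.SymVhSliceReflectionAn1` imports this module unchanged.

# `BalabanUV.Beta.SymRootedKernelReflection` — binder row D1, TABLES-SYM-LEAN step S2e #1 (hR, FIRST ORDER): **THE REFLECTION LAWS OF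
# an1's SYMMETRISED FIRST-ORDER AVERAGING KERNELS AND PACKED TABLES at the centred root** (`L` odd, EVERY axis) — the port of an5's
# `Beta.RootedKernelReflection` §§3–7 from the comb words `γ^ρ` of node 7aρ to the `(σ,σ′)`-PAIR WORDS `γ^{σ,σ′}` of gen 41's (0.4) averaging
# (`Beta.SymAveragingHessianCountsWords.gammaPAt`), letter level and packed; the binder `hHr` of the roots of record becomes a theorem

HONEST FRAMING (cell charter, verbatim): «discharging `BetaPertH` makes Bałaban's UV stability UNCONDITIONAL — a real constructive-QFT
result; it is NOT the continuum limit and NOT the Clay problem.»  DERIVED cell leaf (pub-balaban β sub-cell, row BETA, lane an1, gen 43):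
[folklore] transport of structure (finite letter-list algebra + sign bookkeeping) for gen 41's symmetrised kernels `symLinKerAt`,
`symHessKerAt`, `symVhKerAt` (`Beta.SymAveragingHessianCounts` §7) and their packings `symVhSAt`, `symVhSaddAt`, `symHessFFAt` (§8 there) at
the CENTRED root `ρ_c = ctr d L`, `L` odd, under the block-compatible reflection of one lattice axis (`Beta.ResolventReflection.sref/bref/R1`,
gen 42's `Beta.SymmetrisedAxialReflection`).  No statement of Bałaban's papers is typed here, no `[cite:]` tag, no `Prop` fact, no
`BetaPertH`; NOT continuum; NOT Clay.  Nothing printed is asserted; one [our object] `symCtE` (the contact family, asserting nothing).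

WHAT IS PROVED (`α` the reflected axis, `ε_κ = reflSign α κ`, integer copy `zsgn`; bond map `fref α (κ, x) = (κ, bref α κ x)`; block map
`y ↦ y′ = bref α μ y`; root `ρ_c = ctr d L`, `Odd L`; `q_sym = symLinCountAt` (weight `d!`), `h_sym = symHessCountAt`, `m_sym = symVhCountAt`):

* §1 transport of the pair words: `axialP_R1`; **`gammaPAt_R1_of_ne`** (`μ ≠ α`: `γ^{σ,σ′}_{ρ_c}(R₁A)_{(μ,y),b} = γ^{σ,σ′}_{ρ_c}(A)_{(μ,y′),b̄}`) and
  **`gammaPAt_R1_self`** — ALONG THE AXIS THE TWO ORDERS SWAP AND THE WORD REVERSES: `γ^{σ,σ′}(R₁A)_{(α,y),b} = rev γ^{σ′,σ}(A)_{(α,y′),b̄}`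
  (so no per-`(σ,σ′)` sign law exists on the axis; the DOUBLE SUM `Σ_σ Σ_{σ′}` absorbs the swap) — and of the pair-form words
  (`gammaPAt_pairForm_R1_of_ne/_self`, via S2b's landed projections `SymAveragingWardRooted.bg_/fl_gammaPAt_pairForm` BY NAME), whence the wedge
  law for the double sum   **`sum_wedge_gammaPAt_pairForm_R1`** `Σ_{σσ′} wedge γ^{σσ′}(R₁A, R₁B)_{(μ,y),b} = ε_μ Σ_{σσ′} wedge γ^{σσ′}(A, B)_{(μ,y′),b̄}`;
* §2 `sum_sum_gammaPAt_sum` (`Σ_b Σ_{σσ′} Σγ = d! • symLinU`; the one-line corollary of S2b's landed `SymAveragingWardRooted.sum_pair_gammaPAt_sum`) and **`symHessCountAt_eq_sum_wedge`** — for EVERY root: `h_sym ρ L μ y f f′ =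
  Σ_{b} Σ_{σσ′} wedge γ^{σσ′}_{ρ}(δ_f, δ_{f′})` (the closing-bond terms of gen 41's three-term formula cancel against the closing segment);
* §3–§4 casts: `cast_symLinCountAt` (`= symLinAvgAt ρ (single f 1)`), `cast_symHessCountAt`;
* §5 THE PURE SIGN LAWS **`symLinCountAt_fref`** `q_sym(f̄)_{(μ,y)} = ε_{f.1} ε_μ q_sym(f)_{(μ,y′)}` (gen 42's `symLinAvgAt_R1` on `single f 1`),
  **`symHessCountAt_fref`** `h_sym(f̄,f̄′)_{(μ,y)} = ε_{f.1} ε_{f′.1} ε_μ h_sym(f,f′)_{(μ,y′)}`, and the product chart UP TO TWO CONTACTS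
  **`symVhCountAt_fref`** `ε_{f.1}ε_{f′.1} m_sym(f̄,f̄′) = ε_μ m_sym(f,f′) − 2ε_μ L^d d! [f = f′ ∥ α] q_sym(f) − (1 − ε_μ) q_sym(f) q_sym(f′)` (at `(μ,y′)`);
* §6 the same laws for the real kernels: **`symLinKerAt_fref`**, **`symHessKerAt_fref`**, **`symVhKerAt_fref`** (shape of an5's `vhKerAt_fref`
  verbatim with `q¹ ↦ q¹_sym`: contacts `−ε_μ [f = f′ ∥ α] q¹_sym(f)` and `−[μ = α] q¹_sym(f) q¹_sym(f′)`);
* §7 the transport: **`TKer_symHessKerAt`** (`h_sym` invariant), the contact family **`symCtE α L`** `= [f = f′ ∥ α] q¹_sym(f) − [μ = α] q¹_sym(f) q¹_sym(f′)`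
  ([our object]) with **`TKer_symCtE`** (`𝒯_α E^sym_α = −E^sym_α`) and **`TKer_symVhKerAt`** (`𝒯_α m_sym = m_sym − E^sym_α`);
* §8 THE PACKED LAWS in the (Sr)/(Wr) currency of `Beta.ResolventReflection` (dimension `n + 1`, root `ctr (n+1) L`), by an5's generic
  `packVH_bref` / `packVH_(anti)reflect_of_TKer` BY NAME: **`symVhSaddAt_reflect`** (the ADDITIVE-CHART family obeys `hSr` VERBATIM, every axis),
  **`symVhSAt_bref`** `symVhSAt ρ_c κ′ (bref α κ′ u) = ε_{κ′} • refK (Φ L α) (symVhSAt ρ_c κ′ u − packVH E^sym_α L κ′ u)` (the (V-r) letter in kernel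
  currency), **`symCtS_antireflect`**, **`symVhSAt_half_reflect`**, **`symHessFFAt_reflect`** `symHessFFAt ρ_c L μ (bref α μ y) = ε_μ • refK (Φ N α)
  (symHessFFAt ρ_c L μ y)` (any blocking `N`), and at the root of record (`n + 1 = 4`, `N = L = Lc`) **`hHr_sym`** — the binder `hHr` of
  `RowD1JointEndSymReflTablesAn1S2(M).d1Drift_JsB12Sym_an1TablesS2_of_…` (ROOT F :133 = ROOT G :133), VERBATIM.

USE: S2e #2 `Beta.SymVhSliceReflectionAn1` turns `symVhSAt_bref` into the three border letters `hVfm`/`hVmf`/`hVmm` of the same roots against the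
symmetrised bordered Hessian `bhK Lc + Dsh Lc` (e3's border-reading generator `ctGenM`); with `hHr_sym` the four hR FIRST-ORDER table letters of
the roots of record are theorems.  The SECOND-ORDER letters `hV2`/`hH2` and the `hW*` letters are S2d's (`Beta.SymSecondOrderTablesAn1` ff.).

Provenance: b2b-balaban β sub-cell, row BETA, lane an1 (W-supplier «AN1»), gen 43, 2026-08-21 (TABLES-SYM-LEAN S2e; GAPS § C-an1-134); over an5's
`Beta.RootedKernelReflection` v1.1 (list algebra, `fref`/`zsgn`, `TKer`, `packVH_bref`, `packVH_(anti)reflect_of_TKer`, `cCountAt_fref` BY NAME), gen 41's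
`Beta.SymAveragingHessianCounts(Words)`, S2b's `Beta.SymAveragingWardRooted` (`bg_/fl_gammaPAt_pairForm`, `sum_pair_gammaPAt_sum`, `symZ_eq_symLinU`) and
gen 42's `Beta.SymmetrisedAxialReflection` (`symLinAvgAt_R1`, `P1_R1`, `psite_symm_sref`) BY NAME — nothing of theirs re-typed.  Bib keys (locators only): Balaban1985Averaging, Balaban1987RG1.

VERSION v1 (2026-08-21, b2b-balaban-beta-an1-g43): new leaf (1 def `symCtE` + theorems; `--kind definition`).
VERSION v1.1 (2026-08-21, b2b-balaban-beta-an1-g43, before filing): the two local copies of the family-independent projections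
`bg_/fl_gammaPAt_pairForm` DELETED in favour of the landed `SymAveragingWardRooted` originals (imported, opened BY NAME — the `dedup.landed` rule);
`sum_sum_gammaPAt_sum` re-proved from the landed `sum_pair_gammaPAt_sum`; no statement of any other declaration changed.
COURIER CUT (2026-08-21, b2b-balaban-beta-d1-formalise-leaf-05-g21): part 2 of 2 = §§6–8 of an1-g43's v1.1 (1 def `symCtE`; `--kind definition`); imports part 1 `Beta.SymRootedKernelReflectionCore`.
-/

noncomputable section

namespace Summit.QuantumFields.BalabanUV.Beta.SymRootedKernelReflection

open Finset
open scoped BigOperators Nat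
open Literature.MathematicalPhysics.QuantumFieldTheory.Balaban1983to89.Beta
open AffineAveraging (Form1 Site unitVec box toSite)
open AveragingContours (segUp segDown rev axial rev_sum segUp_length)
open AveragingContoursRooted (ctr)
open TransportedContourVariables (mapForm mapForm_apply pairForm pairForm_apply bg fl bg_append fl_append segUp_map rev_map
  mapForm_fst_pairForm mapForm_snd_pairForm)
open AveragingHessianKernels (wedge wedge_nil wedge_cons Bond single single_apply δ1 smulPair smulPair_apply pairForm_single
  single_eq_mapForm packVH packVH_inl_inr packVH_inr_inl packVH_inl_inl packVH_inr_inr)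
open AveragingHessianKernelsRooted (cCountAt)
open PolarizationSign (reflSign axisReflect)
open ResolventReflection (sref sref_add bref bref_bref bref_of_ne bref_self R1 R1_apply bflip bflip_mem bflip_bflip sum_box_bflip
  sref_block reflSign_self reflSign_of_ne reflSign_mul_self axisReflect_zsmul axisReflect_unitVec_of_ne axisReflect_unitVec_self
  Φ Φ_r_inl Φ_r_inr Φ_s_inl Φ_s_inr)
open RootedComb (segUp_R1_of_ne segUp_R1_self segDown_eq_rev_segUp sref_root_ctr rev_append rev_rev axial_R1)
open RootedKernelReflection (wedge_append bg_rev fl_rev wedge_rev wedge_map_mul wedge_map_smulPair_one eq_of_bg_fl bg_segUp_pairForm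
  fl_segUp_pairForm fref fref_injective fref_fst fref_fref zsgn zsgn_self zsgn_of_ne zsgn_mul_self cast_zsgn R1_single single_fref
  cCountAt_fref cast_cCountAt TKer TKer_apply packVH_bref packVH_sub packVH_neg packVH_reflect_of_TKer packVH_antireflect_of_TKer)
open KernelReflection (refK refK_apply)
open Summit.QuantumFields.BalabanUV.Beta.KernelPermutation (psite psite_apply psite_symm_apply)
open Summit.QuantumFields.BalabanUV.Beta.ResolventPermutation (P1 P1_apply)
open Summit.QuantumFields.BalabanUV.Beta.SymmetrisedAxialPotential (axialPerm symAxial symLinAvgAt card_perm_fin)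
open Summit.QuantumFields.BalabanUV.Beta.SymmetrisedAxialReflection (psite_symm_sref P1_R1 symLinAvgAt_R1)
open Summit.QuantumFields.BalabanUV.Beta.SymAveragingWardRooted (bg_gammaPAt_pairForm fl_gammaPAt_pairForm sum_pair_gammaPAt_sum symZ_eq_symLinU)
open Summit.QuantumFields.BalabanUV.Beta.SymAveragingHessianCounts

variable {d : ℕ}

/-! ## §6 The laws for the real symmetrised kernels (`q¹_sym = LIN∕(d!·L^d)`, `h_sym = HESS∕(2(d!)²L^d)`, `m_sym = VH∕(2(d!)²L^{2d})`) -/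

/-- [folklore] `q¹_sym(f̄)_{(μ,y)} = ε_{f.1} ε_μ q¹_sym(f)_{(μ,y′)}`. -/
theorem symLinKerAt_fref {L : ℕ} (hL : Odd L) (α μ : Fin d) (y : Fin d → ℤ) (f : Bond d) :
    symLinKerAt (ctr d L) L μ y (fref α f) = reflSign α f.1 * reflSign α μ * symLinKerAt (ctr d L) L μ (bref α μ y) f := by
  rw [symLinKerAt, symLinKerAt, symLinCountAt_fref hL]
  push_cast
  rw [cast_zsgn, cast_zsgn]
  ring

/-- [folklore] `h_sym(f̄,f̄′)_{(μ,y)} = ε_{f.1} ε_{f′.1} ε_μ h_sym(f,f′)_{(μ,y′)}`. -/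
theorem symHessKerAt_fref {L : ℕ} (hL : Odd L) (α μ : Fin d) (y : Fin d → ℤ) (f f' : Bond d) :
    symHessKerAt (ctr d L) L μ y (fref α f) (fref α f')
      = reflSign α f.1 * reflSign α f'.1 * reflSign α μ * symHessKerAt (ctr d L) L μ (bref α μ y) f f' := by
  rw [symHessKerAt, symHessKerAt, symHessCountAt_fref hL]
  push_cast
  rw [cast_zsgn, cast_zsgn, cast_zsgn]
  ring

/-- [folklore] **THE REAL SYMMETRISED PRODUCT-CHART KERNEL UNDER THE REFLECTION** — same shape as an5's `vhKerAt_fref`: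
`m_sym(f̄,f̄′)_{(μ,y)} = ε_{f.1} ε_{f′.1} ( ε_μ m_sym(f,f′)_{(μ,y′)} − ε_μ [f = f′ ∧ f ∥ α] q¹_sym(f)_{(μ,y′)} − [μ = α] q¹_sym(f) q¹_sym(f′) )`. -/
theorem symVhKerAt_fref {L : ℕ} (hL : Odd L) (α μ : Fin d) (y : Fin d → ℤ) (f f' : Bond d) :
    symVhKerAt (ctr d L) L μ y (fref α f) (fref α f')
      = reflSign α f.1 * reflSign α f'.1 *
          (reflSign α μ * symVhKerAt (ctr d L) L μ (bref α μ y) f f'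
            - reflSign α μ * (if f = f' ∧ f.1 = α then symLinKerAt (ctr d L) L μ (bref α μ y) f else 0)
            - (if μ = α then symLinKerAt (ctr d L) L μ (bref α μ y) f * symLinKerAt (ctr d L) L μ (bref α μ y) f' else 0)) := by
  have hL0 : (L : ℝ) ≠ 0 := by
    have : 1 ≤ L := hL.pos
    exact_mod_cast (by omega : L ≠ 0)
  have hLd : (L : ℝ) ^ d ≠ 0 := pow_ne_zero _ hL0
  have hd : ((d ! : ℕ) : ℝ) ≠ 0 := Nat.cast_ne_zero.2 (Nat.factorial_ne_zero d)
  have h2d : (L : ℝ) ^ (2 * d) = (L : ℝ) ^ d * (L : ℝ) ^ d := by rw [two_mul, pow_add]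
  rw [symVhKerAt, symVhKerAt, symLinKerAt, symLinKerAt, symVhCountAt_fref hL, h2d]
  push_cast
  rw [cast_zsgn, cast_zsgn, cast_zsgn]
  by_cases hμ : μ = α
  · rw [if_pos hμ, hμ, reflSign_self]
    split_ifs
    · field_simp
      ring
    · field_simp
      ring
  · rw [if_neg hμ, reflSign_of_ne hμ]
    split_ifs
    · field_simp
      ring
    · field_simp
      ring

/-! ## §7 The transport: `h_sym` is invariant, `m_sym` picks up the contact family `E^sym_α` -/

/-- [folklore] **`h_sym` IS TRANSPORT-INVARIANT** (§6 `symHessKerAt_fref`, centred root, `L` odd). -/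
theorem TKer_symHessKerAt {L : ℕ} (hL : Odd L) (α : Fin d) :
    TKer α (symHessKerAt (ctr d L) L) = symHessKerAt (ctr d L) L := by
  funext μ y f f'
  rw [TKer_apply, symHessKerAt_fref hL, bref_bref]
  have h1 := reflSign_mul_self α f.1
  have h2 := reflSign_mul_self α f'.1
  have h3 := reflSign_mul_self α μ
  linear_combination (symHessKerAt (ctr d L) L μ y f f' * (reflSign α f'.1 * reflSign α f'.1) * (reflSign α μ * reflSign α μ)) * h1
    + (symHessKerAt (ctr d L) L μ y f f' * (reflSign α μ * reflSign α μ)) * h2 + (symHessKerAt (ctr d L) L μ y f f') * h3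

/-- [our object] **THE CONTACT FAMILY OF THE SYMMETRISED PRODUCT CHART** for the reflection of axis `α` — an5's `ctE` with `q¹ ↦ q¹_sym`:
`E^sym_α μ y f f′ := [f = f′ ∧ f ∥ α] q¹_sym(f)_{(μ,y)} − [μ = α] q¹_sym(f)_{(μ,y)} q¹_sym(f′)_{(μ,y)}`. -/
noncomputable def symCtE (α : Fin d) (L : ℕ) : Fin d → (Fin d → ℤ) → Bond d → Bond d → ℝ := fun μ y f f' =>
  (if f = f' ∧ f.1 = α then symLinKerAt (ctr d L) L μ y f else 0)
    - (if μ = α then symLinKerAt (ctr d L) L μ y f * symLinKerAt (ctr d L) L μ y f' else 0)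

/-- [folklore] **THE CONTACT FAMILY IS TRANSPORT-ODD**: `𝒯_α E^sym_α = −E^sym_α`. -/
theorem TKer_symCtE {L : ℕ} (hL : Odd L) (α : Fin d) : TKer α (symCtE α L) = -symCtE α L := by
  funext μ y f f'
  simp only [TKer_apply, symCtE, Pi.neg_apply, fref_fst, symLinKerAt_fref hL, bref_bref, (fref_injective α).eq_iff]
  set q := symLinKerAt (ctr d L) L μ y f with hq
  set q' := symLinKerAt (ctr d L) L μ y f' with hq'
  have h1 := reflSign_mul_self α f.1
  have h2 := reflSign_mul_self α f'.1
  by_cases hff : f = f' ∧ f.1 = α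
  · have e1 : reflSign α f.1 = -1 := by rw [hff.2]; exact reflSign_self α
    have e2 : reflSign α f'.1 = -1 := by rw [← hff.1, hff.2]; exact reflSign_self α
    simp only [if_pos hff, e1, e2]
    by_cases hμ : μ = α
    · have e3 : reflSign α μ = -1 := by rw [hμ]; exact reflSign_self α
      simp only [if_pos hμ, e3]; ring
    · simp only [if_neg hμ, reflSign_of_ne hμ]; ring
  · simp only [if_neg hff]
    by_cases hμ : μ = α
    · have e3 : reflSign α μ = -1 := by rw [hμ]; exact reflSign_self α
      simp only [if_pos hμ, e3]
      linear_combination (q * q' * (reflSign α f'.1 * reflSign α f'.1)) * h1 + (q * q') * h2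
    · simp only [if_neg hμ]; ring

/-- [folklore] **THE SYMMETRISED PRODUCT-CHART KERNEL UNDER THE TRANSPORT**: `𝒯_α m_sym = m_sym − E^sym_α` (§6 `symVhKerAt_fref`). -/
theorem TKer_symVhKerAt {L : ℕ} (hL : Odd L) (α : Fin d) :
    TKer α (symVhKerAt (ctr d L) L) = symVhKerAt (ctr d L) L - symCtE α L := by
  funext μ y f f'
  simp only [TKer_apply, Pi.sub_apply, symCtE, symVhKerAt_fref hL, bref_bref]
  set v := symVhKerAt (ctr d L) L μ y f f' with hv
  set q := symLinKerAt (ctr d L) L μ y f with hq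
  set q' := symLinKerAt (ctr d L) L μ y f' with hq'
  have h1 := reflSign_mul_self α f.1
  have h2 := reflSign_mul_self α f'.1
  by_cases hff : f = f' ∧ f.1 = α
  · have e1 : reflSign α f.1 = -1 := by rw [hff.2]; exact reflSign_self α
    have e2 : reflSign α f'.1 = -1 := by rw [← hff.1, hff.2]; exact reflSign_self α
    rw [if_pos hff, e1, e2]
    by_cases hμ : μ = α
    · rw [if_pos hμ, hμ, reflSign_self]; ring
    · rw [if_neg hμ, reflSign_of_ne hμ]; ring
  · rw [if_neg hff]
    by_cases hμ : μ = α
    · rw [if_pos hμ, hμ, reflSign_self]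
      linear_combination ((v + q * q') * (reflSign α f'.1 * reflSign α f'.1)) * h1 + (v + q * q') * h2
    · rw [if_neg hμ, reflSign_of_ne hμ]
      linear_combination (v * (reflSign α f'.1 * reflSign α f'.1)) * h1 + v * h2

/-! ## §8 The packed laws at the centred root, in the (Sr)/(Wr) currency of `Beta.ResolventReflection` — the letters (V-r)(H-r) of an1's
first-order symmetrised tables `symVhSAt ρ_c`, `symVhSaddAt ρ_c`, `symHessFFAt ρ_c` -/

section Packed

open ExpKernelCalculus (MKer)
open OneStepResolventKernel (Fib)

variable {n : ℕ}

/-- [folklore] **(Sr) FOR THE SYMMETRISED ADDITIVE-CHART FIELD–MULTIPLIER STENCIL FAMILY** (`symVhSaddAt = packVH h_sym`, centred root,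
`L` odd): `symVhSaddAt ρ_c L κ′ (bref α κ′ u) = ε_{κ′} • refK (Φ L α) (symVhSaddAt ρ_c L κ′ u)` — EVERY axis, the shape `hSr` verbatim. -/
theorem symVhSaddAt_reflect {L : ℕ} (hL : Odd L) (α κ' : Fin (n + 1)) (u : Fin (n + 1) → ℤ) :
    symVhSaddAt (ctr (n + 1) L) n L rfl κ' (bref α κ' u)
      = reflSign α κ' • refK (Φ L α) (symVhSaddAt (ctr (n + 1) L) n L rfl κ' u) :=
  packVH_reflect_of_TKer _ hL.pos (TKer_symHessKerAt hL α) κ' u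

/-- [folklore] **THE SYMMETRISED PRODUCT-CHART STENCIL FAMILY: (Sr) UP TO THE PACKED CONTACT STENCIL** —
`symVhSAt ρ_c L κ′ (bref α κ′ u) = ε_{κ′} • refK (Φ L α) (symVhSAt ρ_c L κ′ u − packVH E^sym_α L κ′ u)` (the (V-r) letter, kernel currency). -/
theorem symVhSAt_bref {L : ℕ} (hL : Odd L) (α κ' : Fin (n + 1)) (u : Fin (n + 1) → ℤ) :
    symVhSAt (ctr (n + 1) L) n L rfl κ' (bref α κ' u)
      = reflSign α κ' • refK (Φ L α) (symVhSAt (ctr (n + 1) L) n L rfl κ' u - packVH (symCtE α L) L κ' u) := by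
  show packVH (symVhKerAt (ctr (n + 1) L) L) L κ' (bref α κ' u) = _
  rw [packVH_bref _ hL.pos, TKer_symVhKerAt hL, packVH_sub]
  rfl

/-- [folklore] **THE PACKED CONTACT STENCIL IS (Sr)-ANTICOVARIANT**. -/
theorem symCtS_antireflect {L : ℕ} (hL : Odd L) (α κ' : Fin (n + 1)) (u : Fin (n + 1) → ℤ) :
    packVH (symCtE α L) L κ' (bref α κ' u) = -(reflSign α κ' • refK (Φ L α) (packVH (symCtE α L) L κ' u)) :=
  packVH_antireflect_of_TKer _ hL.pos (TKer_symCtE hL α) κ' u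

/-- [folklore] **THE HALF-CORRECTED SYMMETRISED PRODUCT-CHART STENCIL IS (Sr)-COVARIANT FOR ITS OWN AXIS**: `m_sym − ½E^sym_α` obeys `hSr` at `α`. -/
theorem symVhSAt_half_reflect {L : ℕ} (hL : Odd L) (α κ' : Fin (n + 1)) (u : Fin (n + 1) → ℤ) :
    symVhSAt (ctr (n + 1) L) n L rfl κ' (bref α κ' u) - (1 / 2 : ℝ) • packVH (symCtE α L) L κ' (bref α κ' u)
      = reflSign α κ' • refK (Φ L α)
          (symVhSAt (ctr (n + 1) L) n L rfl κ' u - (1 / 2 : ℝ) • packVH (symCtE α L) L κ' u) := by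
  rw [symVhSAt_bref hL, symCtS_antireflect hL]
  funext x z a b
  simp only [Pi.smul_apply, Pi.sub_apply, Pi.neg_apply, smul_eq_mul, refK_apply]
  ring

/-- [folklore] **(H-r): THE (Wr)-TYPE LAW FOR THE PACKED SYMMETRISED W-HESSIAN OF THE CONSTRAINT** (`symHessFFAt`, field–field block;
centred root, `L` odd; ANY blocking `N` of the leg map): `symHessFFAt ρ_c L μ (bref α μ y) = ε_μ • refK (Φ N α) (symHessFFAt ρ_c L μ y)` —
the binder `hHr` of the roots of record about an1's `symHessFFAt (ctr 4 Lc) Lc`, at `n + 1 = 4`, `N = L = Lc`. -/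
theorem symHessFFAt_reflect {L : ℕ} (hL : Odd L) (N : ℕ) (α μ : Fin (n + 1)) (y : Fin (n + 1) → ℤ) :
    symHessFFAt (ctr (n + 1) L) L μ (bref α μ y) = reflSign α μ • refK (Φ N α) (symHessFFAt (ctr (n + 1) L) L μ y) := by
  funext x x' a b
  simp only [Pi.smul_apply, smul_eq_mul, refK_apply]
  rcases a with β | ν
  · rcases b with β' | ν'
    · simp only [Φ_s_inl, Φ_r_inl, symHessFFAt_inl_inl]
      have h := symHessKerAt_fref hL α μ (bref α μ y) (β, bref α β x) (β', bref α β' x')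
      simp only [fref, bref_bref] at h
      rw [h]
      ring
    · simp
  · simp

/-- [folklore] **(H-r) AT THE ROOT OF RECORD** (`d + 1 = 4`, centred root `ctr 4 Lc`, `Lc` odd): the binder `hHr` of
`RowD1JointEndSymReflTablesAn1S2(M).d1Drift_JsB12Sym_an1TablesS2_of_…`, verbatim. -/
theorem hHr_sym {Lc : ℕ} (hLc : Odd Lc) : ∀ (α μ : Fin 4) (y : Fin 4 → ℤ),
    symHessFFAt (ctr 4 Lc) Lc μ (bref α μ y) = reflSign α μ • refK (Φ (d := 3) Lc α) (symHessFFAt (ctr 4 Lc) Lc μ y) :=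
  fun α μ y => symHessFFAt_reflect hLc Lc α μ y

end Packed

end Summit.QuantumFields.BalabanUV.Beta.SymRootedKernelReflection
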